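import Literature.MathematicalPhysics.QuantumFieldTheory.Balaban1983to89.B9Eq346MixedLegAtCubesTorusL2
import Literature.MathematicalPhysics.QuantumFieldTheory.Balaban1983to89.B9Eq346GradGpDivAtPinsL2
import Literature.MathematicalPhysics.QuantumFieldTheory.Balaban1983to89.B9RWSums346MixedPair

/-!
# `Balaban1983to89.B9Eq346MixedLegAtPinsL2` — T. Bałaban, *Propagators for lattice gauge theories in a background field*, Commun. Math. Phys. **99**
# (1985) 389–434 [Balaban1985BackgroundPropagators] Cor 3.6 p. 408 ∕ (3.46) p. 398 ∕ (3.87)–(3.90) pp. 408–410: ★★★ **THE MIXED `L²` LEG OF THE THEOREM-3.7 WALK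
# — dag-n06-k's `L2MixedLegs37.lm` FIELD `BlockBd blk blk (Dd ν ∘ (M_{h_c} G′_c M_{h_c}) ∘ Dsd μ) (1_{S_c}(a)·B_M·e^{−δd})` — PROVED AT THE N06 CERTIFICATE's COORDINATE
# MODELS** (node00-def-Y's `hTY`, `GsqY` on `cubeDomY`, `cdSL ∕ cdsSL`, read through dag-n06-d's `hWalkY ∕ gsqcoS ∕ (η⁻¹ • coordOpK)` in the trace basis, blocks
# `blkSK (sIK bI)`, print's `S_□ = SblkY`), letter-generic under the pin equations the walk-letter instance (FILE C-2) will make `rfl`, member- and □-uniform constants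

statement-level skeleton of published theorems with citation tags; proofs where landed; nothing here is a claim about the Yang–Mills mass gap

THE PRINT.  p. 398 (3.46) (*«‖h∇_UG′(U)∇\*_Uλ‖ ≤ B₀·e^{−δ₀d(y,y′)}‖h‖‖λ‖»*); p. 408 Cor 3.6 (*«constants independent of □»*), p. 409 (3.87) `G′₀ = Σ_□ h_□G′_□h_□`, (3.88)–(3.90)
(the walk); [4] (2.51)–(2.54) pp. 232–233, (2.45)–(2.46) p. 231, Lemma 2.1 (2.61) p. 234, p. 235 (the cubes `□̃`), p. 247 (`|∂h_□| ≤ O(1)(MLʲη)⁻¹`).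

WHY THIS FILE (cell context; the located hand «coordinate reading of the rows-18 `L²` legs» TAKEN by width seat `pub-ymgap-dag-n06-w7` on the knit owner dag-n06-d's word,
pub-ymgap bus 2026-08-28).  The N06 certificate (dag-n06-d, editions `…N06AtOpsYNuOfRecordV6EPairN*`) displays in rows 18's `h36H` the conjunct
`L2MixedLegs37 (𝔬 x) (𝔡 x) 1 (H x) (SM x) pM.BM p.δ₀ U` (dag-n06-k `B9RWSums346MixedPair`).  The prequel `B9Eq346MixedLegAtCubesTorusL2` proved its analytic content at
def-Y's letters (dag-n06-w1's Agmon estimate at `h = hTY c`, `D = cubeDomY x c`; uniform constant `40 + 704K + 1024K²`, `K = (5C₁∕8)²L⁴`; the output lives on `□̃(c)`);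
`B9Eq346GradGpDivCoordsL2` ∕ `…AtPinsL2` (this seat) supply the Parseval dictionary and the pulled-back re-blocking engine.  THIS FILE assembles them:
* §1 THE DICTIONARY: `mulOp_hWalkY_eq_coordOpK` (the real cut-off `M_{h_c}` on the carrier IS the coordinate model of `cutMulY (hTY c)`), ★ `mixedLeg_model_eq` — the pinned
  composite `(η⁻¹ • coordOpK ∇_ν) ∘ (M_{h_c} · gsqcoS · M_{h_c}) ∘ (η⁻¹ • coordOpK ∇\*_μ)` IS `c_R • coordOpK (∇_ν M_{h_c} G′_c M_{h_c} ∇\*_μ)` (`η⁻¹·η²·η⁻¹ = 1`: an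
  order-zero lattice operator, member-uniform — dag-n06-d's functor calculus);
* §2 `blockBd_torus_coordOpKH_mixedLeg` — the torus-level block bound of that model (the prequel's HS bound through `blockBd_fst_coordOpKH_of_hs`, kernel
  `√(40+704K+1024K²)·e^{δ₀(1+1∕(2L))}·e^{−δ₁d_T}`, `δ₁ = δ₀∕(2L)`); `coordOpKH_mixedLeg_apply_eq_zero_off` (the model's output vanishes at carrier points whose site block
  `sIK bI` is off `SblkY x bI c`);
* §3 ★★★ `blockBd_mixedLeg_memberY` — there are `M_M, a_M, B_M, δ_M > 0` such that for every member above the threshold, in the certificate's OWN regime prefix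
  `M_M ≤ M_x → ∀ α₀ > 0, c₀·M_x·α₀ ≤ a_M → ∀ U, (bg9Y…).Reg335 c₀ α₀ U → …`, for every level-∕1-faithful `bI`, `R₀ H₀`, and ALL walk-letter records `𝔬 𝔡` whose fields are
  PINNED (`hblk hh hGsq hDd hDsd`) to `blkSK (sIK bI)`, `hWalkY x c`, `gsqcoS … (parSymY …) c U`, `η⁻¹ • coordOpK (cdSL U ν)`, `η⁻¹ • coordOpK (cdsSL U μ)`: the `lm` body
  `BlockBd (toB6 (geo9Y x) R₀ H₀) 𝔬.blk 𝔬.blk (𝔡.Dd U ν ∘ₗ ((mulOp (𝔬.h ic) * 𝔬.Gsq U ic * mulOp (𝔬.h ic)) ∘ₗ 𝔡.Dsd U μ)) (1_{SblkY x bI c}(a)·B_M·e^{−δ_M d})`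
  (any index type `ι`, one `ic : ι` pinned to the cube `c`); ★★★ `l2MixedLegs37_memberY` — at `ι := cubes`, pins for all cubes: the SCHEMA ITSELF
  `L2MixedLegs37 𝔬 𝔡 R₀ H₀ (SblkY x bI) B_M δ_M U`.  The knit displays `p.δ₀ ≤ δ_M`, `B_M ≤ pM.BM` (or takes these constants) and `SM x := SblkY x (bI x)` — its own
  overlap count `B9WalkLettersCoordsS.sum_indicator_SblkY_le` applies verbatim.
HONEST SCOPE.  A READING of a proved estimate into the certificate's block-`L²` leg shape: functor calculus, Parseval, [4] (2.52)–(2.54)∕(2.61) bookkeeping; the analytic input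
is dag-n06-w1's theorem through the prequel; nothing of [B9] beyond it asserted; the second-order leg `L2SecondLegs37`, the factor schemas and the A-side `310` twins are NOT
here; the constants are CLOSED in the proof (a `…Closed` twin names them if the knit wants TERMS).  Count-neutral; N06 NOT discharged; K1⁷ NOT closed; one finite lattice at a
time — nothing continuum ∕ OS ∕ mass gap ∕ Clay.  Cell `pub-ymgap` (HUMAN RULING D-0062 ∕ D-0154), Track A node N06 [B9], width seat `pub-ymgap-dag-n06-w7` (g0), 2026-08-28.
NEW file; 0 `def`; imports BUILT modules only; nothing landed is modified.
-/

noncomputable section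

namespace Literature.MathematicalPhysics.QuantumFieldTheory.Balaban1983to89.B9Eq346MixedLegAtPinsL2

open Literature.MathematicalPhysics.QuantumFieldTheory.Balaban1983to89
open Node00 B6KLevelCensusIndexV1 B6Geom246MultiLevelBox B6MultiLevelTorusOperator B6GlobalChartV1 B9BackgroundsKLevelV1
  B9Eq39Adjoint B6Geom246MultiLevelTorus B9Eq346MixedLegAtCubesTorusL2 B9Eq346GradGpDivCoordsL2 B9Eq346GradGpDivAtPinsL2
open Literature.MathematicalPhysics.QuantumFieldTheory.Balaban1983to89.B6Ineq2142KLevelV1 (lvl β)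
open Literature.MathematicalPhysics.QuantumFieldTheory.Balaban1983to89.B9Thm314GpFlatMultiLevelTorus (consts_260_261)
open Literature.MathematicalPhysics.QuantumFieldTheory.Balaban1983to89.B6Lemma21Repaired (Ineq261With)
open Literature.MathematicalPhysics.QuantumFieldTheory.Balaban1983to89.B9GeoNormsKLevelV1 (geo9K)
open Literature.MathematicalPhysics.QuantumFieldTheory.Balaban1983to89.B9GeoLemma21KLevelV1 (one_le_Mh)
open Literature.MathematicalPhysics.QuantumFieldTheory.Balaban1983to89.B9Ineq349SiteComposite (cdSL cdsSL cdSL_apply cdsSL_apply etaS_pos)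
open Literature.MathematicalPhysics.QuantumFieldTheory.Balaban1983to89.B9Thm39ReadingCoords (cR39 cR39_nonneg)
open Literature.MathematicalPhysics.QuantumFieldTheory.Balaban1983to89.B9CoReadingCoords (assembleK coordOpK coordOpK_apply coordOpK_comp)
open Literature.MathematicalPhysics.QuantumFieldTheory.Balaban1983to89.B9CoReadingCoordsH (coordOpKH)
open Literature.MathematicalPhysics.QuantumFieldTheory.Balaban1983to89.B9CoReadingCoordsS (XSK blkSK sIK GcoS blkV1_site)
open Literature.MathematicalPhysics.QuantumFieldTheory.Balaban1983to89.B9CoReadingCoordsTranspose (TrIdx trBasis)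
open Literature.MathematicalPhysics.QuantumFieldTheory.Balaban1983to89.B9Thm34Ext (toB6)
open Literature.MathematicalPhysics.QuantumFieldTheory.Balaban1983to89.B9SectDL2Decay (bsq bl2 BlockBd bsq_nonneg bl2_nonneg)
open Literature.MathematicalPhysics.QuantumFieldTheory.Balaban1983to89.B9PinMembersKLevelV1 (MemberY geo9Y bg9Y reg335Y_iff)
open Literature.MathematicalPhysics.QuantumFieldTheory.Balaban1983to89.B9Thm37Sum (mulOp)
open Literature.MathematicalPhysics.QuantumFieldTheory.Balaban1983to89.B9Thm37Whole (Ops)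
open Literature.MathematicalPhysics.QuantumFieldTheory.Balaban1983to89.B9RWSums346SecondDiffGp (DirOps37)
open Literature.MathematicalPhysics.QuantumFieldTheory.Balaban1983to89.B9RWSums346MixedPair (L2MixedLegs37)
open Literature.MathematicalPhysics.QuantumFieldTheory.Balaban1983to89.B9Thm37CubeCoverCommutators (cutMulY cutMulY_apply hTY)
open Literature.MathematicalPhysics.QuantumFieldTheory.Balaban1983to89.B6Partition118KLevelFineSizes (C1F)
open Literature.MathematicalPhysics.QuantumFieldTheory.Balaban1983to89.B6Cover236MultiLevelBlocks (cubes)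
open Literature.MathematicalPhysics.QuantumFieldTheory.Balaban1983to89.B9WalkLettersCoordsS (cubeDomY SblkY hWalkY gsqcoS)
open Literature.MathematicalPhysics.QuantumFieldTheory.Balaban1983to89.Node00.OpsYLocalInverse (GsqY)
open Literature.MathematicalPhysics.QuantumFieldTheory.Balaban1983to89.Node00.OpsYSectDCoords (repr_assembleK coordOpKH_eq_coordOpK)
open scoped Matrix Matrix.Norms.L2Operator

variable {d ℓ : ℕ} {hd : 1 ≤ d + 1} {hL : Odd (ℓ + 1) ∧ 1 < ℓ + 1} {b₀ b₁ : ℝ} {Mstar : ℕ}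
variable (x : MemberY d ℓ hd hL b₀ b₁ Mstar) {N : ℕ} {G : Subgroup (Matrix (Fin N) (Fin N) ℂ)ˣ}

/-! ## §1 The dictionary: the cut-off on the carrier; the pinned composite as ONE scaled coordinate model -/

section Dictionary

/-- `restrictScalars` through composition (definitional). [cite: Balaban1985BackgroundPropagators, (3.88) p.409, dictionary] -/
theorem restrictScalars_comp' {T₁ T₂ T₃ : Type} (f : (T₂ → Matrix (Fin N) (Fin N) ℂ) →ₗ[ℂ] (T₃ → Matrix (Fin N) (Fin N) ℂ))
    (g : (T₁ → Matrix (Fin N) (Fin N) ℂ) →ₗ[ℂ] (T₂ → Matrix (Fin N) (Fin N) ℂ)) :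
    (f ∘ₗ g).restrictScalars ℝ = f.restrictScalars ℝ ∘ₗ g.restrictScalars ℝ := rfl

/-- ★ **THE REAL CUT-OFF `M_{h_c}` ON THE COORDINATE CARRIER IS THE COORDINATE MODEL OF `cutMulY (hTY c)`** (a real scalar commutes with the trace coordinates).
[cite: Balaban1985BackgroundPropagators, (3.87) p.409 (h_□), p.397 (3.42) (coordinates), dictionary] -/
theorem mulOp_hWalkY_eq_coordOpK (c : ↥(cubes x.toKIdx.D.toDomains)) :
    mulOp (hWalkY (κ := TrIdx N) x c) = coordOpK (trBasis N) (fun _ : Fin (d + 1) => (cutMulY (𝔸 := Matrix (Fin N) (Fin N) ℂ) (hTY x.toKIdx c)).restrictScalars ℝ) := by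
  apply LinearMap.ext; intro f; funext p
  rw [coordOpK_apply, LinearMap.restrictScalars_apply, cutMulY_apply, Complex.coe_smul, map_smul, Finsupp.smul_apply, smul_eq_mul, repr_assembleK]
  rfl

/-- ★ **THE PINNED COMPOSITE `Dd ν ∘ (M_h · Gsq · M_h) ∘ Dsd μ` IS `c_R • coordOpK (∇_{U,ν} M_{h_c} G′_c(U) M_{h_c} ∇\*_{U,μ})`** at the pins `Dd ν = η⁻¹ • coordOpK (cdSL ν)`,
`Gsq = gsqcoS = (η²c_R) • coordOpK (G′_c)`, `Dsd μ = η⁻¹ • coordOpK (cdsSL μ)`, `h = hWalkY` — the units `η⁻¹·η²·η⁻¹` cancel to an order-zero lattice operator (dag-n06-d's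
functor calculus). [cite: Balaban1985BackgroundPropagators, (3.87)–(3.88) p.409, (3.46) p.398, (3.42) p.397, dictionary] -/
theorem mixedLeg_model_eq (B : B9.Backgrounds) (cfg : B.Cfg → CfgY (Matrix (Fin N) (Fin N) ℂ) x.toKIdx) (U₁ : B.Cfg) (c : ↥(cubes x.toKIdx.D.toDomains)) (ν μ : Fin (d + 1)) :
    ((etaS x.toKIdx)⁻¹ • coordOpK (trBasis N) (fun _ : Fin (d + 1) => (cdSL x.toKIdx (cfg U₁) ν).restrictScalars ℝ)) ∘ₗ
        ((mulOp (hWalkY x c) * gsqcoS x (trBasis N) B cfg (parSymY x.toKIdx) c U₁ * mulOp (hWalkY x c)) ∘ₗ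
          ((etaS x.toKIdx)⁻¹ • coordOpK (trBasis N) (fun _ : Fin (d + 1) => (cdsSL x.toKIdx (cfg U₁) μ).restrictScalars ℝ)))
      = cR39 (trBasis N) • coordOpK (trBasis N) (fun _ : Fin (d + 1) =>
          (cdSL x.toKIdx (cfg U₁) ν ∘ₗ cutMulY (hTY x.toKIdx c) ∘ₗ GsqY x.toKIdx (parSymY x.toKIdx) (cubeDomY x c) (cfg U₁) ∘ₗ
            cutMulY (hTY x.toKIdx c) ∘ₗ cdsSL x.toKIdx (cfg U₁) μ).restrictScalars ℝ) := by
  have hη : etaS x.toKIdx ≠ 0 := (etaS_pos x.toKIdx).ne'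
  rw [mulOp_hWalkY_eq_coordOpK]
  unfold gsqcoS GcoS
  simp only [Module.End.mul_eq_comp, LinearMap.smul_comp, LinearMap.comp_smul, LinearMap.comp_assoc, coordOpK_comp, restrictScalars_comp', smul_smul]
  congr 1
  field_simp

end Dictionary

/-! ## §2 The torus-level block bound of the model, and its output support -/

section Torus

open Classical in
/-- the torus-level block bound of `coordOpKH (trBasis N) (fun _ => ∇_ν M_{h_c} G′_c M_{h_c} ∇\*_μ)` w.r.t. the site block map along `Prod.fst`, from the prequel's HS bound:
kernel `√(40+704K+1024K²)·e^{δ₀(1+1∕(2L))}·e^{−δ₁·d_T}`, `δ₁ = δ₀∕(2L)`, `δ₀ = 1∕(4(d+2))`, `K = (5C₁∕8)²L⁴`.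
[cite: Balaban1985BackgroundPropagators, Cor 3.6 p.408, (3.46) p.398; Balaban1984PropagatorsII, (2.46) p.231, (2.54) p.233; Agmon1982, Ch.1, Thm 1.5] -/
theorem blockBd_torus_coordOpKH_mixedLeg [Nonempty (Fin N)] (hG : G ≤ B7Prop2Explicit.unitaryUnits (Matrix (Fin N) (Fin N) ℂ))
    {U : CfgY (Matrix (Fin N) (Fin N) ℂ) x.toKIdx} {c₀ α₀ : ℝ} (hC0 : 0 ≤ c₀ * (geo9Y x).M * α₀) (hC1 : c₀ * (geo9Y x).M * α₀ * ((d : ℝ) + 1) ≤ 1 / 16)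
    (hreg : (bg9K (Matrix (Fin N) (Fin N) ℂ) G x.toKIdx).Reg335 c₀ α₀ U) (c : ↥(cubes x.toKIdx.D.toDomains)) (ν μ : Fin (d + 1)) :
    BlockBd (g := geomT x.toKIdx.D) (fun p : XSK (TrIdx N) x.toKIdx => blkOf x.toKIdx.D.toDomains p.1) (fun p : XSK (TrIdx N) x.toKIdx => blkOf x.toKIdx.D.toDomains p.1)
      (coordOpKH (trBasis N) (fun _ : Fin (d + 1) =>
        (cdSL x.toKIdx U ν ∘ₗ cutMulY (hTY x.toKIdx c) ∘ₗ GsqY x.toKIdx (parSymY x.toKIdx) (cubeDomY x c) U ∘ₗ cutMulY (hTY x.toKIdx c) ∘ₗ cdsSL x.toKIdx U μ).restrictScalars ℝ))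
      (fun t s => Real.sqrt (40 + 704 * ((5 * C1F d ℓ / 8) ^ 2 * (((ℓ + 1 : ℕ) : ℝ)) ^ 4) + 1024 * ((5 * C1F d ℓ / 8) ^ 2 * (((ℓ + 1 : ℕ) : ℝ)) ^ 4) ^ 2)
        * Real.exp ((1 / (4 * ((d : ℝ) + 2))) * (1 + 1 / (2 * ((ℓ + 1 : ℕ) : ℝ))))
        * Real.exp (-((1 / (4 * ((d : ℝ) + 2))) / (2 * ((ℓ + 1 : ℕ) : ℝ)) * (geomT x.toKIdx.D).dist t s))) := by
  set δ₀ : ℝ := 1 / (4 * ((d : ℝ) + 2)) with hδ₀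
  set L2 : ℝ := 2 * ((ℓ + 1 : ℕ) : ℝ) with hL2
  set CM : ℝ := 40 + 704 * ((5 * C1F d ℓ / 8) ^ 2 * (((ℓ + 1 : ℕ) : ℝ)) ^ 4) + 1024 * ((5 * C1F d ℓ / 8) ^ 2 * (((ℓ + 1 : ℕ) : ℝ)) ^ 4) ^ 2 with hCM
  have hCM0 : 0 ≤ CM := by positivity
  have hL2pos : 0 < L2 := by rw [hL2]; positivity
  have hK : BlockBd (g := geomT x.toKIdx.D) (fun p : XSK (TrIdx N) x.toKIdx => blkOf x.toKIdx.D.toDomains p.1) (fun p : XSK (TrIdx N) x.toKIdx => blkOf x.toKIdx.D.toDomains p.1)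
      (coordOpKH (trBasis N) (fun _ : Fin (d + 1) =>
        (cdSL x.toKIdx U ν ∘ₗ cutMulY (hTY x.toKIdx c) ∘ₗ GsqY x.toKIdx (parSymY x.toKIdx) (cubeDomY x c) U ∘ₗ cutMulY (hTY x.toKIdx c) ∘ₗ cdsSL x.toKIdx U μ).restrictScalars ℝ))
      (fun t s => Real.sqrt CM * (Real.exp (δ₀ * (((((bondT x.toKIdx.D).dist t s : ℝ)) - 1) / L2 - 1)))⁻¹) := by
    refine blockBd_fst_coordOpKH_of_hs (fun t s => by positivity) fun Λ t s hΛ => ?_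
    have h := hs_block_cdS_hTY_GsqY_hTY_cdsS_le x hG (U := U) hC0 hC1 hreg c ν μ s t hΛ
    have hK2 : (Real.sqrt CM * (Real.exp (δ₀ * (((((bondT x.toKIdx.D).dist t s : ℝ)) - 1) / L2 - 1)))⁻¹) ^ 2
        = CM / Real.exp (δ₀ * (((((bondT x.toKIdx.D).dist t s : ℝ)) - 1) / L2 - 1)) ^ 2 := by
      rw [mul_pow, Real.sq_sqrt hCM0, inv_pow]
      exact (div_eq_mul_inv _ _).symm
    rw [hK2, ← B9Ineq369CurvatureSmallAtLettersY.trIP_one_self_eq, Finset.sum_ite, Finset.sum_const_zero, add_zero]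
    convert h using 3
    all_goals first | rfl | skip
    -- the summand, up to the (definitional) unfolding of the site type in the binder
    rename_i _ z z' hz
    have hzz : z = z' := eq_of_heq hz
    subst hzz
    rfl
  refine hK.mono fun t s => le_of_eq ?_
  have hdist : (geomT x.toKIdx.D).dist t s = (((bondT x.toKIdx.D).dist t s : ℝ)) := rfl
  rw [hdist, ← Real.exp_neg, mul_assoc (Real.sqrt CM), ← Real.exp_add]
  congr 2
  rw [hL2]
  field_simp
  ring

/-- the model's output vanishes at every carrier point whose site block `sIK bI` is NOT in `S_□(c) = SblkY x bI c` (the leg's output lives on `□̃(c)`, prequel).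
[cite: Balaban1985BackgroundPropagators, (3.87) p.409, (3.3) p.390; Balaban1984PropagatorsII, p.235, bookkeeping] -/
theorem coordOpKH_mixedLeg_apply_eq_zero_off (bI : FBondY x.toKIdx → IBondY x.toKIdx) (c : ↥(cubes x.toKIdx.D.toDomains)) (U : CfgY (Matrix (Fin N) (Fin N) ℂ) x.toKIdx)
    (ν μ : Fin (d + 1)) (f : XSK (TrIdx N) x.toKIdx → ℝ) (p : XSK (TrIdx N) x.toKIdx) (hp : sIK x.toKIdx bI p.1 ∉ SblkY x bI c) :
    coordOpKH (trBasis N) (fun _ : Fin (d + 1) =>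
      (cdSL x.toKIdx U ν ∘ₗ cutMulY (hTY x.toKIdx c) ∘ₗ GsqY x.toKIdx (parSymY x.toKIdx) (cubeDomY x c) U ∘ₗ cutMulY (hTY x.toKIdx c) ∘ₗ cdsSL x.toKIdx U μ).restrictScalars ℝ) f p = 0 := by
  have hz : p.1 ∉ cubeDomY x c := fun h => hp (Finset.mem_image_of_mem _ h)
  rw [coordOpKH_eq_coordOpK, coordOpK_apply, LinearMap.restrictScalars_apply]
  simp only [LinearMap.comp_apply, cdSL_apply]
  rw [cdS_cutMulY_apply_eq_zero_of_not_mem x c U ν _ hz, map_zero, Finsupp.zero_apply]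

/-- a function vanishing on the block of `y` has block-`L²` size `0` there. [cite: Balaban1984PropagatorsII, (2.51) p.232, bookkeeping] -/
theorem bl2_eq_zero_of_forall {G' : B6.Geometry} {X₁ : Type} [Fintype X₁] (blk : X₁ → G'.Site) (y : G'.Site) {f : X₁ → ℝ} (hf : ∀ p, blk p = y → f p = 0) :
    bl2 (g := G') blk y f = 0 := by
  classical
  have h : bsq (g := G') blk y f = 0 := by
    unfold bsq
    refine Finset.sum_eq_zero fun p _ => ?_
    split_ifs with hp
    · rw [hf p hp]; ring
    · rfl
  unfold bl2
  rw [h, Real.sqrt_zero]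

end Torus

/-! ## §3 The leg at the certificate's pins -/

section AtPins

/-- ★★★ **THE MIXED `L²` LEG OF THE THEOREM-3.7 WALK AT THE CERTIFICATE's PINS** (dag-n06-k's `L2MixedLegs37.lm` body, letter-generic): there are `M_M, a_M, B_M, δ_M > 0`
(on `d, ℓ, N, c₀`) such that for `G ≤ U(N)`, `N ≥ 1`, every member `x` with `M_M ≤ M_x`, every `α₀ > 0` with `c₀·M_x·α₀ ≤ a_M`, every configuration `U` of the member in the
(3.35) class, every level-∕1-faithful `bI`, every `R₀ H₀`, and ALL walk-letter records `𝔬 𝔡` (any index type `ι`, one index `ic` pinned to the cube `c`) with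
`𝔬.blk = blkSK (sIK bI)`, `𝔬.h ic = hWalkY x c`, `𝔬.Gsq U ic = gsqcoS x (trBasis N) (bg9Y…) id (parSymY x.toKIdx) c U`, `𝔡.Dd U ν = η⁻¹ • coordOpK (cdSL U ν)`,
`𝔡.Dsd U μ = η⁻¹ • coordOpK (cdsSL U μ)`:
`BlockBd (toB6 (geo9Y x) R₀ H₀) 𝔬.blk 𝔬.blk (𝔡.Dd U ν ∘ₗ ((mulOp (𝔬.h ic) * 𝔬.Gsq U ic * mulOp (𝔬.h ic)) ∘ₗ 𝔡.Dsd U μ)) (1_{SblkY x bI c}(a)·B_M·e^{−δ_M·d(a,a′)})`.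
[cite: Balaban1985BackgroundPropagators, Cor 3.6 p.408, Thm 3.1 (3.46) p.398, (3.87)–(3.90) pp.409–410, (3.35) p.396; Balaban1984PropagatorsII, (2.46) p.231, (2.51)–(2.54) pp.232–233, Lemma 2.1 (2.61) p.234, p.235; Agmon1982, Ch.1, Thm 1.5] -/
theorem blockBd_mixedLeg_memberY (d ℓ : ℕ) (hd : 1 ≤ d + 1) (hL : Odd (ℓ + 1) ∧ 1 < ℓ + 1) (b₀ b₁ : ℝ) (Mstar N : ℕ) [NeZero N] {c₀ : ℝ} (hc₀ : 0 < c₀) :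
    ∃ MM aM BM δM : ℝ, 0 < MM ∧ 0 < aM ∧ 0 < BM ∧ 0 < δM ∧
      ∀ {G : Subgroup (Matrix (Fin N) (Fin N) ℂ)ˣ} (_ : G ≤ B7Prop2Explicit.unitaryUnits (Matrix (Fin N) (Fin N) ℂ))
        (x : MemberY d ℓ hd hL b₀ b₁ Mstar), MM ≤ (geo9Y x).M → ∀ α₀ : ℝ, 0 < α₀ → c₀ * (geo9Y x).M * α₀ ≤ aM →
      ∀ (U : (bg9Y (Matrix (Fin N) (Fin N) ℂ) G x).Cfg), (bg9Y (Matrix (Fin N) (Fin N) ℂ) G x).Reg335 c₀ α₀ U →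
      ∀ {bI : FBondY x.toKIdx → IBondY x.toKIdx} (_ : ∀ f, lvl x.hN x.D x.hk (bI f) = (blkV1 x.hN x.D f).1.1)
        (_ : ∀ f, (geomT x.D).dist (β x.hN x.D x.hk (bI f)) (blkV1 x.hN x.D f) ≤ 1) (R₀ : ℝ) (H₀ : Prop) [Fintype (geo9Y x).Site]
        {Y ι : Type} (𝔬 : Ops (geo9Y x) (bg9Y (Matrix (Fin N) (Fin N) ℂ) G x) (XSK (TrIdx N) x.toKIdx) Y ι) (𝔡 : DirOps37 𝔬 (Fin (d + 1)))
        (c : ↥(cubes x.toKIdx.D.toDomains)) (ic : ι) (ν μ : Fin (d + 1))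
        (_ : 𝔬.blk = blkSK x.toKIdx (sIK x.toKIdx bI)) (_ : 𝔬.h ic = hWalkY x c)
        (_ : 𝔬.Gsq U ic = gsqcoS x (trBasis N) (bg9Y (Matrix (Fin N) (Fin N) ℂ) G x) (fun U => U) (parSymY x.toKIdx) c U)
        (_ : 𝔡.Dd U ν = (etaS x.toKIdx)⁻¹ • coordOpK (trBasis N) (fun _ : Fin (d + 1) => (cdSL x.toKIdx U ν).restrictScalars ℝ))
        (_ : 𝔡.Dsd U μ = (etaS x.toKIdx)⁻¹ • coordOpK (trBasis N) (fun _ : Fin (d + 1) => (cdsSL x.toKIdx U μ).restrictScalars ℝ)),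
        BlockBd (g := toB6 (geo9Y x) R₀ H₀) 𝔬.blk 𝔬.blk (𝔡.Dd U ν ∘ₗ ((mulOp (𝔬.h ic) * 𝔬.Gsq U ic * mulOp (𝔬.h ic)) ∘ₗ 𝔡.Dsd U μ))
          (fun a a' => (if a ∈ SblkY x bI c then (1 : ℝ) else 0) * (BM * Real.exp (-(δM * (geo9Y x).dist a a')))) := by
  set δ₀ : ℝ := 1 / (4 * ((d : ℝ) + 2)) with hδ₀
  set δ₁ : ℝ := δ₀ / (2 * ((ℓ + 1 : ℕ) : ℝ)) with hδ₁
  have hδ₀pos : 0 < δ₀ := by rw [hδ₀]; positivity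
  have hδ₁pos : 0 < δ₁ := by rw [hδ₁]; positivity
  obtain ⟨N₁, cr, -, hcr0, hcon⟩ := consts_260_261 d ℓ hδ₁pos
  set C₁ : ℝ := Real.sqrt (40 + 704 * ((5 * C1F d ℓ / 8) ^ 2 * (((ℓ + 1 : ℕ) : ℝ)) ^ 4) + 1024 * ((5 * C1F d ℓ / 8) ^ 2 * (((ℓ + 1 : ℕ) : ℝ)) ^ 4) ^ 2)
    * Real.exp ((1 / (4 * ((d : ℝ) + 2))) * (1 + 1 / (2 * ((ℓ + 1 : ℕ) : ℝ)))) with hC₁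
  have hC₁0 : 0 ≤ C₁ := by positivity
  set BM : ℝ := max (cR39 (trBasis N) * (C₁ * cr * Real.exp (3 / 2 * δ₁) * Real.sqrt (Real.exp (1 / 4 * δ₁) * cr))) 1 with hBM
  refine ⟨(N₁ : ℝ) + 1, 1 / (16 * ((d : ℝ) + 1)), BM, 3 / 4 * δ₁, by positivity, by positivity, lt_of_lt_of_le one_pos (le_max_right _ _), by positivity, ?_⟩
  intro G hG x hM α₀ hα₀ ha U hU bI hlev hβ1 R₀ H₀ _ Y ι 𝔬 𝔡 c ic ν μ hblk hh hGsq hDd hDsd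
  haveI : Nonempty (Fin N) := ⟨⟨0, Nat.pos_of_ne_zero (NeZero.ne N)⟩⟩
  -- the certificate's prefix gives dag-n06-w1's class hypotheses
  have hM0 : 0 ≤ (geo9Y x).M := le_trans (by positivity) hM
  have hC0 : 0 ≤ c₀ * (geo9Y x).M * α₀ := by positivity
  have hC1 : c₀ * (geo9Y x).M * α₀ * ((d : ℝ) + 1) ≤ 1 / 16 := by
    calc c₀ * (geo9Y x).M * α₀ * ((d : ℝ) + 1) ≤ 1 / (16 * ((d : ℝ) + 1)) * ((d : ℝ) + 1) := mul_le_mul_of_nonneg_right ha (by positivity)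
      _ = 1 / 16 := by field_simp
  have hreg : (bg9K (Matrix (Fin N) (Fin N) ℂ) G x.toKIdx).Reg335 c₀ α₀ U := ((reg335Y_iff x c₀ α₀ U).1 hU).1
  -- Lemma 2.1's row sum at the member
  have hLcast : (((ℓ + 1 : ℕ) : ℝ)) = (ℓ : ℝ) + 1 := by push_cast; ring
  have hMdef : (geo9Y x).M = (((ℓ + 1 : ℕ) : ℝ)) * (x.toKIdx.Mh : ℝ) := rfl
  have hN : (N₁ : ℝ) + 1 ≤ ((ℓ : ℝ) + 1) * x.toKIdx.Mh := by rw [← hLcast, ← hMdef]; exact hM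
  have hR1 : 1 ≤ x.toKIdx.R := le_trans (by omega) (toKT x.toKIdx).hR
  have hRN : N₁ + 1 ≤ x.toKIdx.R * ((ℓ + 1) * x.toKIdx.Mh) := by
    have h2 : N₁ + 1 ≤ (ℓ + 1) * x.toKIdx.Mh := by exact_mod_cast hN
    calc N₁ + 1 ≤ 1 * ((ℓ + 1) * x.toKIdx.Mh) := by rw [one_mul]; exact h2
      _ ≤ x.toKIdx.R * ((ℓ + 1) * x.toKIdx.Mh) := Nat.mul_le_mul_right _ hR1
  obtain ⟨-, h261⟩ := hcon x.toKIdx.k x.toKIdx.Mh x.toKIdx.R x.toKIdx.P' (one_le_Mh x.toKIdx) (toKT x.toKIdx).hP hRN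
  have h261D : Ineq261With cr (geomT x.toKIdx.D) δ₁ (1 / 4) := h261 x.toKIdx.D
  -- the torus bound of the model, re-blocked on `blkSK (sIK bI) = bI ∘ π`, `π p = ⟨chart⁻¹ p.1, e₀⟩`, scaled by `c_R`
  have hT := blockBd_torus_coordOpKH_mixedLeg x hG (U := U) hC0 hC1 hreg c ν μ
  have hπ : (fun p : XSK (TrIdx N) x.toKIdx => blkOf x.toKIdx.D.toDomains p.1)
      = (fun p : XSK (TrIdx N) x.toKIdx => blkV1 x.hN x.D ((fun q : XSK (TrIdx N) x.toKIdx => (⟨(boxEquiv x.toKIdx.hN).symm q.1, 0⟩ : FBondY x.toKIdx)) p)) := by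
    funext p; exact (blkV1_site x.toKIdx p.1).symm
  rw [hπ] at hT
  letI : Fintype (geo9K x.toKIdx).Site := (inferInstance : Fintype (geo9Y x).Site)
  have hre := blockBd_pull_bI_of_blockBd_torus x.toKIdx (X := XSK (TrIdx N) x.toKIdx)
    (fun q : XSK (TrIdx N) x.toKIdx => (⟨(boxEquiv x.toKIdx.hN).symm q.1, 0⟩ : FBondY x.toKIdx)) hlev hβ1 hC₁0 hδ₁pos.le hT h261D R₀ H₀
  have hsm := blockBd_smul_of_nonneg' hre (cR39_nonneg (trBasis N))
  rw [coordOpKH_eq_coordOpK] at hsm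
  -- the block map of the engine is the pinned one
  have hblk' : (fun q : XSK (TrIdx N) x.toKIdx => bI (⟨(boxEquiv x.toKIdx.hN).symm q.1, 0⟩ : FBondY x.toKIdx)) = 𝔬.blk := by rw [hblk]; rfl
  rw [hblk'] at hsm
  -- the pinned operator is `c_R •` the model
  rw [hDd, hDsd, hGsq, hh, mixedLeg_model_eq x (bg9Y (Matrix (Fin N) (Fin N) ℂ) G x) (fun U => U) U c ν μ]
  intro a' ω hω a
  dsimp only
  have hle : cR39 (trBasis N) * (C₁ * cr * Real.exp (3 / 2 * δ₁) * Real.sqrt (Real.exp (1 / 4 * δ₁) * cr)) ≤ BM := le_max_left _ _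
  by_cases ha : a ∈ SblkY x bI c
  · rw [if_pos ha, one_mul]
    refine (hsm a' ω hω a).trans ?_
    have hb0 := bl2_nonneg (g := toB6 (geo9Y x) R₀ H₀) 𝔬.blk a' ω
    have hexp0 : 0 ≤ Real.exp (-(3 / 4 * δ₁ * (geo9Y x).dist a a')) := (Real.exp_pos _).le
    calc cR39 (trBasis N) * (C₁ * cr * Real.exp (3 / 2 * δ₁) * Real.sqrt (Real.exp (1 / 4 * δ₁) * cr) * Real.exp (-(3 / 4 * δ₁ * (geo9Y x).dist a a')))
          * bl2 (g := toB6 (geo9Y x) R₀ H₀) 𝔬.blk a' ω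
        = (cR39 (trBasis N) * (C₁ * cr * Real.exp (3 / 2 * δ₁) * Real.sqrt (Real.exp (1 / 4 * δ₁) * cr))) * Real.exp (-(3 / 4 * δ₁ * (geo9Y x).dist a a'))
          * bl2 (g := toB6 (geo9Y x) R₀ H₀) 𝔬.blk a' ω := by ring
      _ ≤ BM * Real.exp (-(3 / 4 * δ₁ * (geo9Y x).dist a a')) * bl2 (g := toB6 (geo9Y x) R₀ H₀) 𝔬.blk a' ω :=
          mul_le_mul_of_nonneg_right (mul_le_mul_of_nonneg_right hle hexp0) hb0
  · rw [if_neg ha, zero_mul, zero_mul]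
    refine le_of_eq (bl2_eq_zero_of_forall (G' := toB6 (geo9Y x) R₀ H₀) 𝔬.blk a fun p hp => ?_)
    have hp' : sIK x.toKIdx bI p.1 ∉ SblkY x bI c := by
      have e : sIK x.toKIdx bI p.1 = a := by rw [← hp, hblk]; rfl
      rw [e]; exact ha
    rw [LinearMap.smul_apply, Pi.smul_apply, smul_eq_mul, ← coordOpKH_eq_coordOpK, coordOpKH_mixedLeg_apply_eq_zero_off x bI c U ν μ ω p hp', mul_zero]

/-- ★★★ **THE SCHEMA ITSELF AT THE PINS** (`ι := cubes`, every cube pinned): in the same regime, for all walk-letter records `𝔬 𝔡` over the cubes of the member with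
`𝔬.blk = blkSK (sIK bI)`, `𝔬.h = hWalkY x`, `𝔬.Gsq U c = gsqcoS … c U`, `𝔡.Dd U ν = η⁻¹ • coordOpK (cdSL U ν)`, `𝔡.Dsd U μ = η⁻¹ • coordOpK (cdsSL U μ)`:
`L2MixedLegs37 𝔬 𝔡 R₀ H₀ (SblkY x bI) B_M δ_M U` — dag-n06-k's rows-18 mixed-leg schema DISCHARGED at node00-def-Y's letters in dag-n06-d's coordinates, print's `S_□`.
[cite: Balaban1985BackgroundPropagators, Cor 3.6 p.408, Thm 3.1 (3.46) p.398, (3.87)–(3.90) pp.409–410, (3.35) p.396; Balaban1984PropagatorsII, (2.46) p.231, (2.51)–(2.54) pp.232–233, Lemma 2.1 (2.61) p.234, p.235; Agmon1982, Ch.1, Thm 1.5] -/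
theorem l2MixedLegs37_memberY (d ℓ : ℕ) (hd : 1 ≤ d + 1) (hL : Odd (ℓ + 1) ∧ 1 < ℓ + 1) (b₀ b₁ : ℝ) (Mstar N : ℕ) [NeZero N] {c₀ : ℝ} (hc₀ : 0 < c₀) :
    ∃ MM aM BM δM : ℝ, 0 < MM ∧ 0 < aM ∧ 0 < BM ∧ 0 < δM ∧
      ∀ {G : Subgroup (Matrix (Fin N) (Fin N) ℂ)ˣ} (_ : G ≤ B7Prop2Explicit.unitaryUnits (Matrix (Fin N) (Fin N) ℂ))
        (x : MemberY d ℓ hd hL b₀ b₁ Mstar), MM ≤ (geo9Y x).M → ∀ α₀ : ℝ, 0 < α₀ → c₀ * (geo9Y x).M * α₀ ≤ aM →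
      ∀ (U : (bg9Y (Matrix (Fin N) (Fin N) ℂ) G x).Cfg), (bg9Y (Matrix (Fin N) (Fin N) ℂ) G x).Reg335 c₀ α₀ U →
      ∀ {bI : FBondY x.toKIdx → IBondY x.toKIdx} (_ : ∀ f, lvl x.hN x.D x.hk (bI f) = (blkV1 x.hN x.D f).1.1)
        (_ : ∀ f, (geomT x.D).dist (β x.hN x.D x.hk (bI f)) (blkV1 x.hN x.D f) ≤ 1) (R₀ : ℝ) (H₀ : Prop) [Fintype (geo9Y x).Site] [DecidableEq (geo9Y x).Site]
        {Y : Type} (𝔬 : Ops (geo9Y x) (bg9Y (Matrix (Fin N) (Fin N) ℂ) G x) (XSK (TrIdx N) x.toKIdx) Y ↥(cubes x.toKIdx.D.toDomains)) (𝔡 : DirOps37 𝔬 (Fin (d + 1)))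
        (_ : 𝔬.blk = blkSK x.toKIdx (sIK x.toKIdx bI)) (_ : ∀ c, 𝔬.h c = hWalkY x c)
        (_ : ∀ c, 𝔬.Gsq U c = gsqcoS x (trBasis N) (bg9Y (Matrix (Fin N) (Fin N) ℂ) G x) (fun U => U) (parSymY x.toKIdx) c U)
        (_ : ∀ ν, 𝔡.Dd U ν = (etaS x.toKIdx)⁻¹ • coordOpK (trBasis N) (fun _ : Fin (d + 1) => (cdSL x.toKIdx U ν).restrictScalars ℝ))
        (_ : ∀ μ, 𝔡.Dsd U μ = (etaS x.toKIdx)⁻¹ • coordOpK (trBasis N) (fun _ : Fin (d + 1) => (cdsSL x.toKIdx U μ).restrictScalars ℝ)),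
        L2MixedLegs37 𝔬 𝔡 R₀ H₀ (SblkY x bI) BM δM U := by
  obtain ⟨MM, aM, BM, δM, hMM, haM, hBM, hδM, H⟩ := blockBd_mixedLeg_memberY d ℓ hd hL b₀ b₁ Mstar N hc₀
  refine ⟨MM, aM, BM, δM, hMM, haM, hBM, hδM, ?_⟩
  intro G hG x hM α₀ hα₀ ha U hU bI hlev hβ1 R₀ H₀ _ _ Y 𝔬 𝔡 hblk hh hGsq hDd hDsd
  -- (the schema's indicator is decided by the certificate's `DecidableEq (geo9Y x).Site`; `convert` identifies the two `Decidable` instances)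
  exact ⟨fun c ν μ => by convert H hG x hM α₀ hα₀ ha U hU hlev hβ1 R₀ H₀ 𝔬 𝔡 c c ν μ hblk (hh c) (hGsq c) (hDd ν) (hDsd μ) using 5; exact Iff.rfl⟩

end AtPins

end Literature.MathematicalPhysics.QuantumFieldTheory.Balaban1983to89.B9Eq346MixedLegAtPinsL2

end
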